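import Literature.MathematicalPhysics.QuantumLattice.FermiRG.FKTLaddersSupportVanishingMomentum
import Literature.MathematicalPhysics.QuantumLattice.FermiRG.FKTLaddersFourierTransport

/-!
# Feldman–Knörrer–Trubowitz, *Particle–Hole Ladders*: the support step for single-position-leg components, and Lemma II.16 at `δ⃗ = 0`

Theorem-only companion of the typer file `FKTLaddersSec1.lean` (F7a, frozen; nothing there is edited)
for the cell `gate-hubbard-kl` (seat hubbard-kl-t10, gen 2), completing the Fourier-support step of
the proof of Lemma II.16 (`\lemLADresectornorm`; tree: the named fact
`FKTLadders.ResectorizationNormBound`, licence F-075 — NOT discharged here: the fact quantifies over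
arbitrary, possibly non-measurable `f`) of J. Feldman, H. Knörrer, E. Trubowitz, *Particle–Hole
Ladders*, Commun. Math. Phys. **247** (2004) 179–194, arXiv:math-ph/0209044
[FeldmanKnorrerTrubowitz2004Ladders], in the printed case `ℓ' < ℓ`, `r' < r` (p.13 L43–44), and
assembling, with hubbard-kl-t11's `FKTLaddersResectorizationCore` (`resectScaledNormMax_zero_le_of_support'`),
**Lemma II.16 at `δ⃗ = (0,0,0)` as a theorem** for measurable, sectorized, translation invariant `f`:
`|f|^{[0,0,0]}_{ℓ,r} ≤ 3⁴ · max(1,cst)⁴ · |f|^{[0,0,0]}_{ℓ',r'}` (`resectScaledNormMax_zero_le`).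

Locators `p.N Ln` = chunk `pNNNN.txt` line `n` of the materialised arXiv TeX, as in F7a.

## The single-position-leg components (the last case of "the other cases are similar", p.13 L44–45)

If leg `ν` is the only position leg of the component `i`, the `s'`-summand of the resectorisation
(Definition I.18) at the argument `y` (position `y_ν`, momenta `k_μ = y_μ`, `μ ≠ ν`) is
`∫ χ̂_{s_ν}((-1)^{b_ν}(y_ν - t)) f|_i(t; k) dt`, and translation invariance (Definition I.4 (ii)) gives
`f|_i(t; k) = e^{i⟨K, t⟩_-} f|_i(0; k)` with `K = Σ_{μ ≠ ν} (-1)^{b_μ} k_μ`; so the summand is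
`c · ∫ χ̂_{s_ν}((-1)^{b_ν}(y_ν - t)) e^{i⟨K,t⟩_-} dt` with `c = f|_i(0; k) = f̌` at the surface momentum
`q_ν = -(-1)^{b_ν} K` (Definition I.5 (ii): the pinned transform over NO remaining position legs).
Either `q_ν ∉ s̃'_ν`, and `c = 0` because `f` is sectorized (Definition I.6); or `q_ν ∈ s̃'_ν`, and
then — this is the geometric input `closure_extSector_inter_extSector_eq_empty`: for admissible data
and a NEW scale `≥ 2` the closure of `s̃_ν` still misses `s̃'_ν` — `χ_{s_ν} ≡ 0` near `q_ν`, so the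
remaining integral, which is `e^{i⟨K,y_ν⟩_-} · (χ_{s_ν}` Fourier-inverted at `q_ν)`, vanishes by the
pointwise inversion theorem of `FKTLaddersFourierTransport`.  No integrability hypothesis is needed
for these components.

## Contents (all proved; no `def`, no named fact)

§1 geometry: `closure_extNbhd_subset_doublyExtNbhdTwo` (scale `≥ 2`), `memArc_of_gamma_mem_image`,
`memArc_proj_of_mem_closure_extSector`, `closure_extSector_inter_extSector_eq_empty`;
§2 `integral_resect_eq_zero_of_extSector_disjoint_single`, `resectTerm_eq_zero_of_extSector_disjoint_single`,
`resectTerm_eq_zero_of_extSector_disjoint_of_one`; §3 ASSEMBLY: `resectTerm_eq_zero_of_extSector_disjoint_all`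
(t11's `hsupp` for every component, strict case) and **`resectScaledNormMax_zero_le`**,
`resectScaledNormMax_zero_le_of_admissible` (Lemma II.16 at `δ⃗ = 0`, `ℓ' < ℓ`, `r' < r`).

Theorem-only: no `instance`, no `notation`; nothing about the Hubbard model is asserted.
-/

noncomputable section

open MeasureTheory Set Filter
open scoped Topology ENNReal

namespace Literature.MathematicalPhysics.QuantumLattice.FermiRG

namespace FKTLadders

/-! ### §1 Geometry: the closure of a finer extended sector misses the disjoint coarser ones -/

section Geometry

variable {S : ScaleData} {e : (Fin 2 → ℝ) → ℝ} {fr : FermiFrame} {re : ℕ}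

/-- For a scale `l ≥ 2` the CLOSURE of the `l`-th extended neighbourhood lies in the second doubly
extended neighbourhood (where the projection on the Fermi curve is smooth): `φ` is non-increasing on
`[0,∞)` and `M^{2l-2} > M`. [cite: FeldmanKnorrerTrubowitz2004Ladders, Definition I.1 (ii) (p.4 L131–135) and Definition I.2 (p.4 L151)] -/
theorem closure_extNbhd_subset_doublyExtNbhdTwo (hS : S.Admissible) (he : Continuous e) {l : ℕ}
    (hl : 2 ≤ l) : closure (extNbhd S e l) ⊆ doublyExtNbhdTwo S e := by
  intro k hk
  set x : SpT → ℝ := fun k => k.1 ^ 2 + e k.2 ^ 2 with hxdef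
  have hx : Continuous x := by
    rw [hxdef]
    fun_prop
  have hM : 0 < S.M := lt_trans zero_lt_one hS.one_lt_M
  show S.φ (S.M ^ (1 : ℤ) * x k) ≠ 0
  by_cases h0 : x k = 0
  · rw [h0, mul_zero, hS.eq_one 0 (by norm_num)]
    exact one_ne_zero
  have hxpos : 0 < x k := lt_of_le_of_ne (by positivity) (Ne.symm h0)
  intro hφ
  set y : ℝ := S.M ^ (1 : ℤ) * x k with hydef
  have hy0 : 0 ≤ y := by positivity
  have hlt : y < S.M ^ ((2 * l : ℤ) - 2) * x k :=
    mul_lt_mul_of_pos_right (zpow_lt_zpow_right₀ hS.one_lt_M (by omega)) hxpos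
  have hU : IsOpen {k' : SpT | y < S.M ^ ((2 * l : ℤ) - 2) * x k'} :=
    isOpen_lt continuous_const (continuous_const.mul hx)
  obtain ⟨k', hk'U, hk'E⟩ := mem_closure_iff.1 hk _ hU hlt
  have hk'U' : y ≤ S.M ^ ((2 * l : ℤ) - 2) * x k' := le_of_lt hk'U
  have hanti := hS.antitoneOn hy0 (hy0.trans hk'U') hk'U'
  have hge := (hS.mem_Icc (S.M ^ ((2 * l : ℤ) - 2) * x k')).1
  apply hk'E
  show S.φ (S.M ^ ((2 * l : ℤ) - 2) * x k') = 0
  rw [hφ] at hanti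
  exact le_antisymm hanti hge

/-- For an admissible frame, `γ θ ∈ γ([a, a + |I|])` forces `θ` into the arc modulo the period
(`γ` is `length(F)`-periodic and injective on a period). [cite: FeldmanKnorrerTrubowitz2004Ladders, Definition I.2 (i) (p.4 L144–151)] -/
theorem memArc_of_gamma_mem_image (hfr : fr.Admissible S e re) {I : Arc} {θ : ℝ}
    (h : fr.γ θ ∈ fr.γ '' Icc I.1 (I.1 + I.2)) : fr.memArc I θ := by
  obtain ⟨θ', hθ', hγ⟩ := h
  have hp : 0 < fr.len := hfr.len_pos
  -- reduce both parameters into the fundamental period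
  have hm : fr.γ (toIcoMod hp 0 θ) = fr.γ θ := by
    rw [← self_sub_toIcoDiv_zsmul hp 0 θ]
    exact hfr.periodic.sub_zsmul_eq _
  have hm' : fr.γ (toIcoMod hp 0 θ') = fr.γ θ' := by
    rw [← self_sub_toIcoDiv_zsmul hp 0 θ']
    exact hfr.periodic.sub_zsmul_eq _
  have h1 : toIcoMod hp 0 θ ∈ Ico 0 fr.len := by simpa using toIcoMod_mem_Ico hp 0 θ
  have h2 : toIcoMod hp 0 θ' ∈ Ico 0 fr.len := by simpa using toIcoMod_mem_Ico hp 0 θ'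
  have heq : toIcoMod hp 0 θ = toIcoMod hp 0 θ' :=
    hfr.injOn h1 h2 (by rw [hm, hm', hγ])
  rw [← self_sub_toIcoDiv_zsmul hp 0 θ, ← self_sub_toIcoDiv_zsmul hp 0 θ'] at heq
  refine ⟨toIcoDiv hp 0 θ' - toIcoDiv hp 0 θ, ?_⟩
  have : θ + ((toIcoDiv hp 0 θ' - toIcoDiv hp 0 θ : ℤ) : ℝ) * fr.len = θ' := by
    rw [zsmul_eq_mul, zsmul_eq_mul] at heq
    push_cast
    linarith
  rw [this]
  exact hθ'

/-- Conversely, a parameter in the arc has `γ θ ∈ γ([a, a + |I|])`. [cite: FeldmanKnorrerTrubowitz2004Ladders, Definition I.2 (i) (p.4 L144–151)] -/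
theorem gamma_mem_image_of_memArc (hfr : fr.Admissible S e re) {I : Arc} {θ : ℝ}
    (h : fr.memArc I θ) : fr.γ θ ∈ fr.γ '' Icc I.1 (I.1 + I.2) := by
  obtain ⟨n, hn⟩ := h
  refine ⟨θ + n * fr.len, hn, ?_⟩
  rw [← zsmul_eq_mul]
  exact hfr.periodic.zsmul n θ

/-- **The projection of a point in the CLOSURE of an extended sector of scale `≥ 2` still lies in its
arc.**  The closure lies in the second doubly extended neighbourhood, where `k ↦ γ(π_F k)` is
continuous (`FermiFrame.Admissible.proj_contDiffOn`), and the arc's image `γ([a, a + |I|])` is compact.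
[cite: FeldmanKnorrerTrubowitz2004Ladders, Definition I.2 (p.4 L144–151) and Definition I.6 (p.5 L115–119)] -/
theorem memArc_proj_of_mem_closure_extSector (hS : S.Admissible) (he : Continuous e)
    (hfr : fr.Admissible S e re) {l : ℕ} (hl : 2 ≤ l) {I : Arc} {k : SpT}
    (hk : k ∈ closure (extSector S e fr l I)) : fr.memArc I (fr.πF k) := by
  -- the closure lies in the doubly extended neighbourhood, which is open
  have hsub : extSector S e fr l I ⊆ extNbhd S e l := fun k hk => hk.1
  have hkW : k ∈ doublyExtNbhdTwo S e :=
    closure_extNbhd_subset_doublyExtNbhdTwo hS he hl (closure_mono hsub hk)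
  have hWopen : IsOpen (doublyExtNbhdTwo S e) := by
    have hc : Continuous fun k : SpT => S.φ (S.M ^ (1 : ℤ) * (k.1 ^ 2 + e k.2 ^ 2)) := by
      have := hS.smooth.continuous
      fun_prop
    exact isOpen_ne_fun hc continuous_const
  -- continuity of `Γ = γ ∘ π_F` at `k`
  have hΓ : ContinuousAt (fun k => fr.γ (fr.πF k)) k :=
    (hfr.proj_contDiffOn.continuousOn.continuousWithinAt hkW).continuousAt (hWopen.mem_nhds hkW)
  -- the arc's image is closed and contains `Γ` of the sector
  have hJ : IsClosed (fr.γ '' Icc I.1 (I.1 + I.2)) :=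
    ((isCompact_Icc).image hfr.contDiff.continuous).isClosed
  haveI : (𝓝[extSector S e fr l I] k).NeBot := mem_closure_iff_nhdsWithin_neBot.1 hk
  have hmem : fr.γ (fr.πF k) ∈ fr.γ '' Icc I.1 (I.1 + I.2) := by
    refine hJ.mem_of_tendsto (hΓ.continuousWithinAt (s := extSector S e fr l I)).tendsto ?_
    exact eventually_of_mem self_mem_nhdsWithin fun k' hk' => gamma_mem_image_of_memArc hfr hk'.2
  exact memArc_of_gamma_mem_image hfr hmem

/-- **Disjoint extended sectors stay disjoint after closing the finer one.**  For admissible ladder data,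
a scale `l ≥ 2` and any scale `l'`: if `s̃_l(a) ∩ s̃_{l'}(b) = ∅` then `closure(s̃_l(a)) ∩ s̃_{l'}(b) = ∅`
— a common point would have its projection parameter in both arcs, and then the Fermi-curve point over
that parameter would lie in both extended sectors. [cite: FeldmanKnorrerTrubowitz2004Ladders, Definition I.6 (p.5 L115–119) with Definition I.2 (p.4 L144–151)] -/
theorem closure_extSector_inter_extSector_eq_empty (D : LadderData) (hD : D.Admissible) {l l' : ℕ}
    (hl : 2 ≤ l) {a b : Arc}
    (h : extSector D.S D.e D.fr l a ∩ extSector D.S D.e D.fr l' b = ∅) :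
    closure (extSector D.S D.e D.fr l a) ∩ extSector D.S D.e D.fr l' b = ∅ := by
  refine Set.eq_empty_iff_forall_notMem.2 fun k hk => ?_
  have he : Continuous D.e := hD.dispersion.contDiff.continuous
  have ha : D.fr.memArc a (D.fr.πF k) :=
    memArc_proj_of_mem_closure_extSector hD.scale he hD.frame hl hk.1
  have hb : D.fr.memArc b (D.fr.πF k) := hk.2.2
  have hP : ((0 : ℝ), D.fr.γ (D.fr.πF k)) ∈
      extSector D.S D.e D.fr l a ∩ extSector D.S D.e D.fr l' b :=
    ⟨curvePoint_mem_extSector hD.scale hD.frame l ha, curvePoint_mem_extSector hD.scale hD.frame l' hb⟩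
  rw [h] at hP
  exact hP

end Geometry

/-! ### §2 The single-position-leg components -/

/-- The leg phase of momentum `0` is `1`. [cite: FeldmanKnorrerTrubowitz2004Ladders, Definition I.4 (ii) (p.5 L52–55)] -/
theorem legPhase_zero_left (μ : Fin 4) (x : SpT) : legPhase μ 0 x = 1 := by
  simp [legPhase, mink_zero_left]

/-- **The off-diagonal terms of a resectorisation vanish — components with exactly one position leg.**
For admissible ladder data, a leg-kind component `i` whose only position leg is `ν`, a function `f`
sectorized at the scales `(jl, jr)` (Definition I.6) and translation invariant (Definition I.4), a new
label `s ν ∈ Σ_{new scale of ν}` with that scale `≥ 2`, old labels `s'`, and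
`s̃_ν(new) ∩ s̃'_ν(old) = ∅`: the resectorisation integral in the leg `ν` (Definition I.18; any
decidable `chg` with `chg μ ↔ μ = ν`) vanishes at every `y`.  No integrability hypothesis: the summand
is `f|_i(0; k) · ∫ χ̂_{s_ν}((-1)^{b_ν}(y_ν - t)) e^{i⟨K,t⟩_-} dt`, `K = Σ_{μ≠ν} (-1)^{b_μ} k_μ`; the first
factor is `f̌` at the conserved momentum `q_ν = -(-1)^{b_ν}K` and vanishes unless `q_ν ∈ s̃'_ν`, in
which case `χ_{s_ν} ≡ 0` near `q_ν` (`closure_extSector_inter_extSector_eq_empty`) and the second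
factor vanishes by Fourier inversion (`integral_chiHat_smul_sub_mul_cexp_eq_zero`).
[cite: FeldmanKnorrerTrubowitz2004Ladders, Lemma II.16, proof (p.13 L43–53, "the other cases are similar, but easier"), with Definitions I.5 (ii), I.6 (p.5 L95–128) and I.18 (p.8 L55–93)] -/
theorem integral_resect_eq_zero_of_extSector_disjoint_single (D : LadderData) (hD : D.Admissible)
    {jl jr jl' jr' : ℕ} {i : LegKind} {f : FourLegFn}
    (hsec : IsSectorized D.S D.e D.fr jl jr f) (htr : IsTranslationInvariant f)
    (s s' : Fin 4 → Arc) (y : Fin 4 → SpT) {ν : Fin 4} (hν1 : i ν = 1)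
    (hone : ∀ μ : Fin 4, i μ = 1 → μ = ν)
    (hnew : 2 ≤ (if ν.val < 2 then jl' else jr'))
    (hsν : s ν ∈ (if ν.val < 2 then D.Sig jl' else D.Sig jr'))
    (hν : extSector D.S D.e D.fr (if ν.val < 2 then jl' else jr') (s ν) ∩
        extSector D.S D.e D.fr (if ν.val < 2 then jl else jr) (s' ν) = ∅)
    (chg : Fin 4 → Prop) [DecidablePred chg] (hchg : ∀ μ, chg μ ↔ μ = ν) :
    ∫ x' : {μ : Fin 4 // chg μ} → SpT,
        (∏ μ : {μ : Fin 4 // chg μ},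
            chiHat (D.χ (if μ.1.val < 2 then jl' else jr') (s μ.1))
              (((-1 : ℝ) ^ bExp μ.1) • (y μ.1 - x' μ))) *
          f i (fun μ => if h : chg μ then x' ⟨μ, h⟩ else y μ) s' = 0 := by
  classical
  -- the unique changing leg and the empty set of other position legs
  have hchgν : chg ν := (hchg ν).2 rfl
  let a : {μ : Fin 4 // chg μ} := ⟨ν, hchgν⟩
  letI hU : Unique {μ : Fin 4 // chg μ} := ⟨⟨a⟩, fun m => Subtype.ext ((hchg m.1).1 m.2)⟩
  haveI hE : IsEmpty {μ : Fin 4 // i μ = 1 ∧ μ ≠ ν} := ⟨fun j => j.2.2 (hone j.1 j.2.1)⟩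
  let u₀ : {μ : Fin 4 // i μ = 1 ∧ μ ≠ ν} → SpT := isEmptyElim
  set χν : SpT → ℝ := D.χ (if ν.val < 2 then jl' else jr') (s ν) with hχν
  set σν : ℝ := (-1 : ℝ) ^ bExp ν with hσν
  set c : ℂ := f i (legIns i y ν 0 u₀) s' with hc
  set K : SpT := ∑ μ : Fin 4, ((-1 : ℝ) ^ bExp μ) • legIns i y ν 0 u₀ μ with hK
  have hnew1 : 1 ≤ (if ν.val < 2 then jl' else jr') := le_trans (by norm_num) hnew
  -- translation invariance: `f|_i(t; k) = e^{i⟨K,t⟩_-} c`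
  have hTI : ∀ t : SpT, f i (legIns i y ν t u₀) s' =
      Complex.exp (Complex.I * (mink K t : ℂ)) * c := by
    intro t
    have h1 : legIns i y ν t u₀ = translate i t (legIns i y ν 0 u₀) := by
      rw [translate_legIns i y hν1 0 t u₀, zero_add]
      congr 1
      funext j
      exact isEmptyElim j
    rw [h1, htr.1 i t _ s', hc]
    congr 1
    rw [hK, ← prod_legPhase_const]
    refine Finset.prod_congr rfl fun μ _ => ?_
    by_cases h0 : i μ = 0
    · rw [if_pos h0]
    · have h1' : i μ = 1 := by omega
      have hμ : μ = ν := hone μ h1'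
      subst hμ
      rw [if_neg h0, legIns_apply_self, legPhase_zero_left]
  -- Step 1: the integrand depends on `x'` only through `t = x' a`
  set G : SpT → ℂ := fun t => c * (chiHat χν (σν • (y ν - t)) *
    Complex.exp (Complex.I * (mink K t : ℂ))) with hG
  have hfu : ∀ x' : {μ : Fin 4 // chg μ} → SpT,
      (MeasurableEquiv.funUnique ({μ : Fin 4 // chg μ}) SpT) x' = x' a := fun x' => rfl
  have hΘ : ∀ x' : {μ : Fin 4 // chg μ} → SpT,
      (∏ μ : {μ : Fin 4 // chg μ},
          chiHat (D.χ (if μ.1.val < 2 then jl' else jr') (s μ.1))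
            (((-1 : ℝ) ^ bExp μ.1) • (y μ.1 - x' μ))) *
        f i (fun μ => if h : chg μ then x' ⟨μ, h⟩ else y μ) s' =
      G ((MeasurableEquiv.funUnique ({μ : Fin 4 // chg μ}) SpT) x') := by
    intro x'
    have hX : (fun μ : Fin 4 => if h : chg μ then x' ⟨μ, h⟩ else y μ) = legIns i y ν (x' a) u₀ := by
      funext μ
      by_cases hμ : μ = ν
      · subst hμ
        rw [dif_pos hchgν, legIns_apply_self]
      · have hc' : ¬ chg μ := fun h => hμ ((hchg μ).1 h)
        have h1 : ¬ i μ = 1 := fun h => hμ (hone μ h)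
        rw [dif_neg hc', legIns_apply_of_mom _ _ _ _ _ h1 hμ]
    rw [hfu, Fintype.prod_unique, hX, hTI, hG]
    show chiHat (D.χ (if (a : {μ : Fin 4 // chg μ}).1.val < 2 then jl' else jr') (s a.1))
        (((-1 : ℝ) ^ bExp a.1) • (y a.1 - x' a)) * (Complex.exp (Complex.I * (mink K (x' a) : ℂ)) * c) =
      c * (chiHat χν (σν • (y ν - x' a)) * Complex.exp (Complex.I * (mink K (x' a) : ℂ)))
    rw [hχν, hσν]
    ring
  simp_rw [hΘ]
  have h2 : (∫ x' : {μ : Fin 4 // chg μ} → SpT, G ((MeasurableEquiv.funUnique ({μ : Fin 4 // chg μ}) SpT) x')) =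
      ∫ t : SpT, G t := by
    convert (volume_preserving_funUnique ({μ : Fin 4 // chg μ}) SpT).integral_comp' G
  rw [h2, hG]
  show ∫ t : SpT, c * (chiHat χν (σν • (y ν - t)) * Complex.exp (Complex.I * (mink K t : ℂ))) = 0
  rw [integral_const_mul]
  -- Step 2: the two cases on the conserved momentum `q_ν = -(σ_ν • K)`
  by_cases hq : -(σν • K) ∈ extSector D.S D.e D.fr (if ν.val < 2 then jl else jr) (s' ν)
  · -- `q_ν ∈ s̃'_ν`: then `χ_{s_ν} ≡ 0` near `q_ν` and the inversion integral vanishes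
    have hcl := closure_extSector_inter_extSector_eq_empty D hD hnew hν
    have hq' : -(σν • K) ∉ closure (extSector D.S D.e D.fr (if ν.val < 2 then jl' else jr') (s ν)) := by
      intro h
      have : -(σν • K) ∈ closure (extSector D.S D.e D.fr (if ν.val < 2 then jl' else jr') (s ν)) ∩
          extSector D.S D.e D.fr (if ν.val < 2 then jl else jr) (s' ν) := ⟨h, hq⟩
      rw [hcl] at this
      exact this
    have hsν' : s ν ∈ D.Sig (if ν.val < 2 then jl' else jr') := by
      have := hsν
      split_ifs at this ⊢ <;> exact this
    have h0 : ∀ᶠ p in 𝓝 (-(σν • K)), χν p = 0 := by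
      filter_upwards [isClosed_closure.isOpen_compl.mem_nhds hq'] with p hp
      by_contra hne
      exact hp (subset_closure (hD.chi_support _ hnew1 _ hsν' hne))
    rw [integral_chiHat_smul_sub_mul_cexp_eq_zero χν σν (neg_one_pow_bExp ν) (y ν) K h0, mul_zero]
  · -- `q_ν ∉ s̃'_ν`: then `c = f̌(q_ν, k) = 0` because `f` is sectorized
    set k : Fin 4 → SpT := legIns i y ν (-(σν • K)) u₀ with hkdef
    have hk : k 0 - k 1 - k 2 + k 3 = 0 := surface_of_legIns i y ν u₀
    have hky : ∀ μ, ¬ i μ = 1 → k μ = y μ := by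
      intro μ h1
      have hμν : μ ≠ ν := by rintro rfl; exact h1 hν1
      exact legIns_apply_of_mom _ _ _ _ _ h1 hμν
    have hkν : k ν ∉ extSector D.S D.e D.fr (if ν.val < 2 then jl else jr) (s' ν) := by
      rw [hkdef, legIns_apply_self]; exact hq
    have hvol : (volume : Measure ({μ : Fin 4 // i μ = 1 ∧ μ ≠ ν} → SpT)) = Measure.dirac u₀ := by
      rw [volume_pi]
      exact Measure.pi_of_empty _ u₀
    have hint' : ∀ π₀ : Fin 4, i π₀ = 1 →
        Integrable fun u : {μ : Fin 4 // i μ = 1 ∧ μ ≠ π₀} → SpT => f i (legIns i k π₀ 0 u) s' := by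
      intro π₀ hπ₀
      have hπν : π₀ = ν := hone π₀ hπ₀
      subst π₀
      rw [hvol]
      have hconst : (fun u : {μ : Fin 4 // i μ = 1 ∧ μ ≠ ν} → SpT => f i (legIns i k ν 0 u) s') =
          fun _ => f i (legIns i k ν 0 u₀) s' := by
        funext u
        rw [Subsingleton.elim u u₀]
      rw [hconst]
      exact integrable_const _
    have hzero := pinFT_eq_zero_of_not_mem_extSector' D.S D.e D.fr hsec htr s' k hk hν1 hint' hν1 hkν
    rw [hvol, integral_dirac, Finset.univ_eq_empty, Finset.prod_empty, one_mul,
      legIns_congr_mom i (fun μ h1 => hky μ h1) ν 0 u₀] at hzero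
    rw [hc, hzero, zero_mul]

/-- **The support input of `resectScaledNormMax_zero_le_of_support` for the components with exactly one
position leg.**  In the `hsupp` binder shape of t11's reduction (old scales `(jl, jr)` of `f`, new
scales `(jl', jr')`; the position leg `ν` changes scale and its new scale is `≥ 2`, which is automatic
when `jl' > jl ≥ 1` resp. `jr' > jr ≥ 1`): the `s'`-summand `resectTerm` (Definition I.18) vanishes
identically, for `f` sectorized and translation invariant — no integrability needed.
[cite: FeldmanKnorrerTrubowitz2004Ladders, Lemma II.16, proof (p.13 L43–53)] -/
theorem resectTerm_eq_zero_of_extSector_disjoint_single (D : LadderData) (hD : D.Admissible)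
    {jl jr jl' jr' : ℕ} {i : LegKind} {f : FourLegFn}
    (hsec : IsSectorized D.S D.e D.fr jl jr f) (htr : IsTranslationInvariant f)
    (s s' : Fin 4 → Arc) (y : Fin 4 → SpT) {ν : Fin 4} (hν1 : i ν = 1)
    (hone : ∀ μ : Fin 4, i μ = 1 → μ = ν)
    (hside : (ν.val < 2 ∧ jl' ≠ jl) ∨ (2 ≤ ν.val ∧ jr' ≠ jr))
    (hnew : 2 ≤ (if ν.val < 2 then jl' else jr'))
    (hsν : s ν ∈ (if ν.val < 2 then D.Sig jl' else D.Sig jr'))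
    (hν : extSector D.S D.e D.fr (if ν.val < 2 then jl' else jr') (s ν) ∩
        extSector D.S D.e D.fr (if ν.val < 2 then jl else jr) (s' ν) = ∅) :
    resectTerm D jl jr jl' jr' f i s s' y = 0 :=
  integral_resect_eq_zero_of_extSector_disjoint_single D hD hsec htr s s' y hν1 hone hnew hsν hν
    (fun μ : Fin 4 => i μ = 1 ∧ ((μ.val < 2 ∧ jl' ≠ jl) ∨ (2 ≤ μ.val ∧ jr' ≠ jr)))
    (fun μ => ⟨fun h => hone μ h.1, fun h => h ▸ ⟨hν1, hside⟩⟩)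

/-- **The printed case `ℓ' < ℓ`, `r' < r` (p.13 L43–44), components with exactly one position leg**, in
the exact binder shape of the `hsupp` premise of t11's `resectScaledNormMax_zero_le_of_support'` (old
scales `(l', r')`, new scales `(l, r)`). [cite: FeldmanKnorrerTrubowitz2004Ladders, Lemma II.16 (p.13 L19–33), proof p.13 L43–53] -/
theorem resectTerm_eq_zero_of_extSector_disjoint_of_one (D : LadderData) (hD : D.Admissible)
    {l l' r r' : ℕ} (hl' : 1 ≤ l') (hl : l' < l) (hr' : 1 ≤ r') (hr : r' < r)
    {f : FourLegFn} (hsec : IsSectorized D.S D.e D.fr l' r' f) (htr : IsTranslationInvariant f)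
    (i : LegKind) (s s' : Fin 4 → Arc) (μ : Fin 4)
    (hs : AdmissibleLabels (D.Sig l) (D.Sig r) i s) (hμ : i μ = 1)
    (hone : ∀ π : Fin 4, i π = 1 → π = μ)
    (hdis : ¬ (extSector D.S D.e D.fr (if μ.val < 2 then l else r) (s μ) ∩
        extSector D.S D.e D.fr (if μ.val < 2 then l' else r') (s' μ)).Nonempty)
    (y : Fin 4 → SpT) :
    resectTerm D l' r' l r f i s s' y = 0 := by
  have hside : (μ.val < 2 ∧ l ≠ l') ∨ (2 ≤ μ.val ∧ r ≠ r') := by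
    by_cases hν : μ.val < 2
    · exact Or.inl ⟨hν, by omega⟩
    · exact Or.inr ⟨by omega, by omega⟩
  have hnew : 2 ≤ (if μ.val < 2 then l else r) := by split_ifs <;> omega
  have hsμ : s μ ∈ (if μ.val < 2 then D.Sig l else D.Sig r) := by
    have h1 := (hs μ).1 hμ
    split_ifs with h
    · exact h1.1 h
    · exact h1.2 (by omega)
  exact resectTerm_eq_zero_of_extSector_disjoint_single D hD hsec htr s s' y hμ hone hside hnew hsμ
    (Set.not_nonempty_iff_eq_empty.1 hdis)

/-! ### §3 Assembly: Lemma II.16 at `δ⃗ = 0` in the printed case `ℓ' < ℓ`, `r' < r` -/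

/-- **The support hypothesis of `resectScaledNormMax_zero_le_of_support'`, discharged for every
component** (strict case): at least two position legs — `FKTLaddersSupportVanishingMomentum`; exactly
one — §2. [cite: FeldmanKnorrerTrubowitz2004Ladders, Lemma II.16, proof (p.13 L43–53)] -/
theorem resectTerm_eq_zero_of_extSector_disjoint_all (D : LadderData) (hD : D.Admissible)
    {l l' r r' : ℕ} (hl' : 1 ≤ l') (hl : l' < l) (hr' : 1 ≤ r') (hr : r' < r)
    {f : FourLegFn} (hsec : IsSectorized D.S D.e D.fr l' r' f) (htr : IsTranslationInvariant f)
    (i : LegKind) (s s' : Fin 4 → Arc) (μ : Fin 4)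
    (hs : AdmissibleLabels (D.Sig l) (D.Sig r) i s) (hμ : i μ = 1)
    (hdis : ¬ (extSector D.S D.e D.fr (if μ.val < 2 then l else r) (s μ) ∩
        extSector D.S D.e D.fr (if μ.val < 2 then l' else r') (s' μ)).Nonempty)
    (y : Fin 4 → SpT)
    (hint : ∀ π₀ : Fin 4, i π₀ = 1 →
      Integrable fun u : {ν : Fin 4 // i ν = 1 ∧ ν ≠ π₀} → SpT => f i (legIns i y π₀ 0 u) s') :
    resectTerm D l' r' l r f i s s' y = 0 := by
  by_cases hπ : ∃ π : Fin 4, i π = 1 ∧ π ≠ μ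
  · exact resectTerm_eq_zero_of_extSector_disjoint_of_two_le D hD hl' hl hr' hr hsec htr i s s' μ hs
      hμ hπ hdis y hint
  · push Not at hπ
    exact resectTerm_eq_zero_of_extSector_disjoint_of_one D hD hl' hl hr' hr hsec htr i s s' μ hs hμ
      hπ hdis y

/-- **Lemma II.16 at `δ⃗ = (0,0,0)` in the printed case `ℓ' < ℓ`, `r' < r` — proved.**  For admissible
ladder data with `χ̂`-decay constant `cst` (`ChiDecayBound`, from `LadderData.Admissible.chi_decay`),
scales `1 ≤ ℓ' < ℓ`, `1 ≤ r' < r`, and `f` on `𝔜_{ℓ',r'}` sectorized (Definition I.6), translation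
invariant (Definition I.4) and with measurable components:
`|f|^{[0,0,0]}_{ℓ,r} ≤ 3⁴ · max(1, cst)⁴ · |f|^{[0,0,0]}_{ℓ',r'}` (Definitions II.13/II.15), i.e. the
second inequality of the Lemma at `δ⃗ = 0` with an explicit constant.  Assembly of t11's reduction
`resectScaledNormMax_zero_le_of_support'` (analytic core + the sector count of
`FKTLaddersSectorCounting`) with the support step (`resectTerm_eq_zero_of_extSector_disjoint_all`; the
slice integrability it needs in the finite case is `integrable_slice_of_scaledNormMax_ne_top`).
Beyond print: measurability of the components (the named fact `ResectorizationNormBound` quantifies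
over arbitrary `f` and is not discharged). [cite: FeldmanKnorrerTrubowitz2004Ladders, Lemma II.16 (p.13 L19–33), proof p.13 L37–72] -/
theorem resectScaledNormMax_zero_le (D : LadderData) (hD : D.Admissible) {cst : ℝ}
    (hχ : ChiDecayBound D cst) {l l' r r' : ℕ} (hl' : 1 ≤ l') (hl : l' < l) (hr' : 1 ≤ r')
    (hr : r' < r) (f : FourLegFn)
    (hf : ∀ (i : LegKind) (s' : Fin 4 → Arc), Measurable fun y : Fin 4 → SpT => f i y s')
    (hsec : IsSectorized D.S D.e D.fr l' r' f) (htr : IsTranslationInvariant f) :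
    resectScaledNormMax D l' r' l r 0 0 0 f ≤
      3 ^ 4 * ENNReal.ofReal (max 1 cst) ^ 4 * scaledNormMax D l' r' 0 0 0 f := by
  refine resectScaledNormMax_zero_le_of_support' D hD hχ hl' hl.le hr' hr.le f hf ?_
  intro hfin i s s' μ hs hs' hμ _ hdis y
  refine resectTerm_eq_zero_of_extSector_disjoint_all D hD hl' hl hr' hr hsec htr i s s' μ hs hμ
    hdis y ?_
  intro π₀ hπ₀
  exact integrable_slice_of_scaledNormMax_ne_top D l' r' f hfin i s' hs' (hf i s') y π₀ hπ₀ 0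

/-- **Lemma II.16 at `δ⃗ = 0`, `ℓ' < ℓ`, `r' < r`, with the constant from the data**: there is a
constant `C < ∞` depending only on the fixed data of §I such that
`|f|^{[0,0,0]}_{ℓ,r} ≤ C · |f|^{[0,0,0]}_{ℓ',r'}` for all such scales and all measurable, sectorized,
translation invariant `f`. [cite: FeldmanKnorrerTrubowitz2004Ladders, Lemma II.16 (p.13 L19–33)] -/
theorem resectScaledNormMax_zero_le_of_admissible (D : LadderData) (hD : D.Admissible) :
    ∃ C : ℝ≥0∞, C ≠ ⊤ ∧ ∀ (l l' r r' : ℕ), 1 ≤ l' → l' < l → 1 ≤ r' → r' < r →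
      ∀ f : FourLegFn, (∀ (i : LegKind) (s' : Fin 4 → Arc), Measurable fun y : Fin 4 → SpT => f i y s') →
        IsSectorized D.S D.e D.fr l' r' f → IsTranslationInvariant f →
          resectScaledNormMax D l' r' l r 0 0 0 f ≤ C * scaledNormMax D l' r' 0 0 0 f := by
  obtain ⟨cst, hχ⟩ := hD.chi_decay
  refine ⟨3 ^ 4 * ENNReal.ofReal (max 1 cst) ^ 4, ?_, ?_⟩
  · exact ENNReal.mul_ne_top (by simp) (ENNReal.pow_ne_top ENNReal.ofReal_ne_top)
  · intro l l' r r' hl' hl hr' hr f hf hsec htr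
    exact resectScaledNormMax_zero_le D hD hχ hl' hl hr' hr f hf hsec htr

/-- **Lemma II.16 at `δ⃗ = 0`, strict scales, in the binder shape of the named fact.**  The body of
`FKTLadders.ResectorizationNormBound` (F-075) specialised to `δ_l = δ_c = δ_r = 0`, strict scales
`ℓ' < ℓ`, `r' < r`, and measurable components — BOTH printed inequalities, with one constant depending
only on the fixed data: `|f|^{[0⃗]}_{ℓ,r} ≤ const { M^{-(ℓ-ℓ')}M^{-(r-r')} |f|^{[0⃗]}_{ℓ',r'}
+ M^{-(ℓ-ℓ')} |f|^{[0⃗]}_{ℓ',r'} + M^{-(r-r')} |f|^{[0⃗]}_{ℓ',r'} + |f|^{[0⃗]}_{ℓ',r'} }` and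
`|f|^{[0⃗]}_{ℓ,r} ≤ const |f|^{[0⃗]}_{ℓ',r'}` (at `δ⃗ = 0` the first follows from the second, all four
norms on the right being the same).  This is the part of F-075 that is now a theorem; the fact itself
(all `δ⃗ ∈ Δ⃗`, `ℓ' ≤ ℓ`, `r' ≤ r`, arbitrary `f`) is not discharged.
[cite: FeldmanKnorrerTrubowitz2004Ladders, Lemma II.16 (p.13 L19–33)] -/
theorem resectorizationNormBound_zero_strict (D : LadderData) (hD : D.Admissible) :
    ∃ cst : ℝ, 0 < cst ∧
      ∀ (l l' r r' : ℕ), 1 ≤ l' → l' < l → 1 ≤ r' → r' < r →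
        ∀ f : FourLegFn, (∀ (i : LegKind) (s' : Fin 4 → Arc), Measurable fun y : Fin 4 → SpT => f i y s') →
          IsSectorized D.S D.e D.fr l' r' f → IsTranslationInvariant f →
          resectScaledNormMax D l' r' l r 0 0 0 f ≤
              ENNReal.ofReal cst *
                (ENNReal.ofReal ((D.S.M ^ (l - l'))⁻¹ * (D.S.M ^ (r - r'))⁻¹) *
                    scaledNormMax D l' r' 0 0 0 f +
                  ENNReal.ofReal ((D.S.M ^ (l - l'))⁻¹) * scaledNormMax D l' r' 0 0 0 f +
                  ENNReal.ofReal ((D.S.M ^ (r - r'))⁻¹) * scaledNormMax D l' r' 0 0 0 f +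
                  scaledNormMax D l' r' 0 0 0 f) ∧
            resectScaledNormMax D l' r' l r 0 0 0 f ≤
              ENNReal.ofReal cst * scaledNormMax D l' r' 0 0 0 f := by
  obtain ⟨c, hχ⟩ := hD.chi_decay
  refine ⟨3 ^ 4 * (max 1 c) ^ 4, by positivity, ?_⟩
  intro l l' r r' hl' hl hr' hr f hf hsec htr
  have hcst : ENNReal.ofReal ((3 : ℝ) ^ 4 * (max 1 c) ^ 4) = 3 ^ 4 * ENNReal.ofReal (max 1 c) ^ 4 := by
    rw [ENNReal.ofReal_mul (by positivity), ENNReal.ofReal_pow (by norm_num),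
      ENNReal.ofReal_pow (by positivity), ENNReal.ofReal_ofNat]
  have h2 : resectScaledNormMax D l' r' l r 0 0 0 f ≤
      ENNReal.ofReal ((3 : ℝ) ^ 4 * (max 1 c) ^ 4) * scaledNormMax D l' r' 0 0 0 f := by
    rw [hcst]
    exact resectScaledNormMax_zero_le D hD hχ hl' hl hr' hr f hf hsec htr
  refine ⟨le_trans h2 ?_, h2⟩
  gcongr
  exact le_add_self

end FKTLadders

end Literature.MathematicalPhysics.QuantumLattice.FermiRG
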